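import Literature.Computability.Complexity.CountingHierarchyPH
import Literature.Computability.Complexity.StringSwap
import HarnessLib

/-!
# `CH` is closed under intersection and union (proofs; trunk CplxCore)

Sibling proof file of `CountingHierarchy.lean` (D-0014), continuing `CountingHierarchyProofs.lean`
and `CountingHierarchyPH.lean`. The levels `CₖP = C'⋯C'·P` of the counting hierarchy are defined
by iterating Gill's/Torán's majority operator (`pMajority`), so closure of a *fixed* level under the
intersection of two of its languages is a deep fact (for `PP = C₁P` it is the theorem of
Beigel–Reingold–Spielman 1995). What the applications need (Bürgisser 2009, §3: Boolean
combinations of the sign and bit languages of `CH`-definable integer sequences) is only closure of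
the *union* `CH = ⋃ₖ CₖP`, and this is elementary once two languages of a level can be merged into
one:

* `tagJoin L₀ L₁ = {⟨x, c y⟩ | x ∈ L_c}` — the **tagged (marked) join**: the tag is the first bit
  of the second component of the pair (membership: `boolPair_cons_mem_tagJoin`);
* `tagJoin_mem_P`, `tagJoin_mem_pMajority`, `tagJoin_mem_CkP` — **every level `CₖP` is closed
  under tagged joins** (induction on `k`: a single witness language
  `{⟨⟨x, c y⟩, r⟩ | ⟨x, r↾p_c(|x|)⟩ ∈ K_c}` serves both branches, with the common coin polynomial
  `p₀ + p₁` and Arora–Barak's coin truncation, `uniformProb_take_of_le`);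
* `inter_mem_pMajority_of_tagJoin` — if `tagJoin L₀ L₁ ∈ K` then `L₀ ∩ L₁ ∈ C'·K`: one coin `c`,
  witness `tagJoin L₀ L₁` itself; both coins accept iff `x ∈ L₀ ∩ L₁` (Torán 1991, §3: Boolean
  closure properties of the counting hierarchy; Wagner 1986);
* `inter_mem_CkP_succ`, `union_mem_CkP_succ` (`L₀, L₁ ∈ CₖP ⇒ L₀ ∩ L₁, L₀ ∪ L₁ ∈ Cₖ₊₁P`),
  **`inter_mem_CH`, `union_mem_CH`**, and the finite versions `iInf_mem_CH`/`iSup_mem_CH` over a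
  `Finset`.

All PROVED from the tree's `FinTM2` toolkit (`copyFn`, `mapFstFn`, `mapSndFn`, `truncSndFn`,
`boolUnpair` projections); no new machine.

## References

* J. Torán, *Complexity classes defined by counting quantifiers*, J. ACM 38 (1991), §3–§4.
* K. W. Wagner, *The complexity of combinatorial problems with succinct input representation*,
  Acta Inform. 23 (1986) 325–356.
* P. Bürgisser, *On defining integers and proving arithmetic circuit lower bounds*, Comput.
  Complexity 18 (2009) = ECCC TR06-113, §2.1, Rem. 2.2, §3.
* S. Arora, B. Barak, *Computational Complexity: A Modern Approach*, CUP 2009, §0.1, Def. 7.3.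
-/

namespace Literature.Computability.Complexity

open _root_.Computability

/-! ### The tagged join of two languages -/

/-- The **tagged join** `L₀ ⊎ L₁ = {⟨x, c y⟩ | x ∈ L_c}` of two languages: the pairs whose second
component starts with the tag bit `c` and whose first component lies in `L_c` (the marked union
of recursion theory, transported to `boolPair`; strings that are not of this form are rejected). [folklore] -/
def tagJoin (L₀ L₁ : Language Bool) : Language Bool :=
  {w | (((boolUnpair w).2).head? = some false ∧ (boolUnpair w).1 ∈ L₀) ∨
    (((boolUnpair w).2).head? = some true ∧ (boolUnpair w).1 ∈ L₁)}

/-- Membership of a tagged pair: `⟨x, c y⟩ ∈ L₀ ⊎ L₁ ↔ x ∈ L_c`. [folklore] -/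
@[simp] theorem boolPair_cons_mem_tagJoin (L₀ L₁ : Language Bool) (x : List Bool) (c : Bool)
    (y : List Bool) : boolPair x (c :: y) ∈ tagJoin L₀ L₁ ↔ (c = false ∧ x ∈ L₀) ∨ (c = true ∧ x ∈ L₁) := by
  change ((boolUnpair (boolPair x (c :: y))).2.head? = some false ∧ _ ∨
    (boolUnpair (boolPair x (c :: y))).2.head? = some true ∧ _) ↔ _
  rw [boolUnpair_boolPair]
  cases c <;> simp

/-- An untagged pair `⟨x, []⟩` is not in the join. [folklore] -/
@[simp] theorem boolPair_nil_notMem_tagJoin (L₀ L₁ : Language Bool) (x : List Bool) :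
    boolPair x [] ∉ tagJoin L₀ L₁ := by
  change ¬ (((boolUnpair (boolPair x [])).2.head? = some false ∧ _) ∨
    ((boolUnpair (boolPair x [])).2.head? = some true ∧ _))
  rw [boolUnpair_boolPair]
  simp

/-- The tagged join as a Boolean combination of the two tag tests (`sndStartsWith`, in `P`) and the
first projections of `L₀`, `L₁`. [folklore] -/
theorem tagJoin_eq (L₀ L₁ : Language Bool) :
    tagJoin L₀ L₁ = (sndStartsWith false ⊓ {w | (boolUnpair w).1 ∈ L₀}) ⊔
      (sndStartsWith true ⊓ {w | (boolUnpair w).1 ∈ L₁}) := by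
  ext w
  rfl

/-- **`P` is closed under tagged joins.** [cite: AroraBarak2009, Thm. 2.8] -/
theorem tagJoin_mem_P {L₀ L₁ : Language Bool} (h₀ : L₀ ∈ Classes.P) (h₁ : L₁ ∈ Classes.P) : tagJoin L₀ L₁ ∈ Classes.P := by
  rw [tagJoin_eq]
  exact union_mem_P
    (inter_mem_P (sndStartsWith_mem_P false) (preimage_mem_P (f := fun z => (boolUnpair z).1) h₀
      boolUnpairFst_mem_FP))
    (inter_mem_P (sndStartsWith_mem_P true) (preimage_mem_P (f := fun z => (boolUnpair z).1) h₁
      boolUnpairFst_mem_FP))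

/-! ### The majority operator preserves closure under tagged joins -/

/-- The re-pairing map of the join construction for the branch with coin polynomial `q`:
`⟨w, r⟩ ↦ ⟨u, r↾q(|u|)⟩` with `u = (boolUnpair w).1` (`truncSndFn q ∘ mapFstFn fst`), in `FP`. [folklore] -/
theorem truncSnd_mapFst_fst_mem_FP (q : Polynomial ℕ) :
    (truncSndFn q ∘ mapFstFn fun z => (boolUnpair z).1) ∈ FP :=
  comp_mem_FP (truncSndFn_mem_FP q) (mapFstFn_mem_FP boolUnpairFst_mem_FP)

/-- Its value on `⟨w, r⟩`. [folklore] -/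
theorem truncSnd_mapFst_fst_apply (q : Polynomial ℕ) (w r : List Bool) :
    (truncSndFn q ∘ mapFstFn fun z => (boolUnpair z).1) (boolPair w r) =
      boolPair (boolUnpair w).1 (r.take (q.eval (boolUnpair w).1.length)) := by
  simp only [Function.comp_apply, mapFstFn_boolPair, truncSndFn_boolPair]

/-- The tag-carrier map `z ↦ ⟨z, (boolUnpair (boolUnpair z).1).2⟩` (copy, then replace the second
copy by the second component of its first component), in `FP`. [folklore] -/
theorem tagCarrier_mem_FP :
    (mapSndFn ((fun z => (boolUnpair z).2) ∘ fun z => (boolUnpair z).1) ∘ copyFn) ∈ FP :=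
  comp_mem_FP (mapSndFn_mem_FP (comp_mem_FP boolUnpairSnd_mem_FP boolUnpairFst_mem_FP))
    copyFn_mem_FP

/-- Its value on `⟨w, r⟩`: `⟨⟨w, r⟩, (boolUnpair w).2⟩`. [folklore] -/
theorem tagCarrier_apply (w r : List Bool) :
    (mapSndFn ((fun z => (boolUnpair z).2) ∘ fun z => (boolUnpair z).1) ∘ copyFn)
        (boolPair w r) = boolPair (boolPair w r) (boolUnpair w).2 := by
  simp only [Function.comp_apply, copyFn_apply, mapSndFn_boolPair, boolUnpair_boolPair]

/-- Unfolded membership in a tagged join. [folklore] -/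
theorem mem_tagJoin_iff (L₀ L₁ : Language Bool) (w : List Bool) :
    w ∈ tagJoin L₀ L₁ ↔ (((boolUnpair w).2).head? = some false ∧ (boolUnpair w).1 ∈ L₀) ∨
      (((boolUnpair w).2).head? = some true ∧ (boolUnpair w).1 ∈ L₁) :=
  Iff.rfl

/-- **`C'·K` is closed under tagged joins when `K` is** (and `K` is closed under polynomial-time
preimages). For `L_c ∈ C'·K` with witnesses `K_c ∈ K` and coin polynomials `p_c` (`c = 0, 1`),
the join `L₀ ⊎ L₁` has the single witness
`W = {⟨w, r⟩ | ⟨u, r↾p_c(|u|)⟩ ∈ K_c, c = tag of w, u = (boolUnpair w).1} = h⁻¹(g₀⁻¹K₀ ⊎ g₁⁻¹K₁)`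
and the coin polynomial `p₀ + p₁`; acceptance probabilities agree with those of the active branch
by the cylinder rule `uniformProb_take_of_le` (Torán 1991, §3; Arora–Barak 2009, Def. 7.3). [cite: Toran1991, §3] -/
theorem tagJoin_mem_pMajority {K : Set (Language Bool)}
    (hK : ∀ ⦃L : Language Bool⦄, L ∈ K → ∀ ⦃g : List Bool → List Bool⦄, g ∈ FP → g ⁻¹' L ∈ K)
    (hJ : ∀ ⦃L₀ : Language Bool⦄, L₀ ∈ K → ∀ ⦃L₁ : Language Bool⦄, L₁ ∈ K → tagJoin L₀ L₁ ∈ K)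
    {L₀ L₁ : Language Bool} (h₀ : L₀ ∈ pMajority K) (h₁ : L₁ ∈ pMajority K) :
    tagJoin L₀ L₁ ∈ pMajority K := by
  obtain ⟨K₀, hK₀, p₀, hp₀⟩ := h₀
  obtain ⟨K₁, hK₁, p₁, hp₁⟩ := h₁
  -- the branch witnesses `A_c = g_c⁻¹(K_c)` and the witness `W = h⁻¹(A₀ ⊎ A₁)` of the join
  set A₀ : Language Bool := (truncSndFn p₀ ∘ mapFstFn fun z => (boolUnpair z).1) ⁻¹' K₀ with hA₀
  set A₁ : Language Bool := (truncSndFn p₁ ∘ mapFstFn fun z => (boolUnpair z).1) ⁻¹' K₁ with hA₁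
  set W : Language Bool :=
    (mapSndFn ((fun z => (boolUnpair z).2) ∘ fun z => (boolUnpair z).1) ∘ copyFn) ⁻¹' tagJoin A₀ A₁
    with hW
  have hWK : W ∈ K :=
    hK (hJ (hK hK₀ (truncSnd_mapFst_fst_mem_FP p₀)) (hK hK₁ (truncSnd_mapFst_fst_mem_FP p₁)))
      tagCarrier_mem_FP
  refine ⟨W, hWK, p₀ + p₁, fun w => ?_⟩
  -- the sections of the witness
  have hmemA₀ : ∀ z r : List Bool, boolPair z r ∈ A₀ ↔
      boolPair (boolUnpair z).1 (r.take (p₀.eval (boolUnpair z).1.length)) ∈ K₀ := fun z r => by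
    change (truncSndFn p₀ ∘ mapFstFn fun z => (boolUnpair z).1) (boolPair z r) ∈ K₀ ↔ _
    rw [truncSnd_mapFst_fst_apply]
  have hmemA₁ : ∀ z r : List Bool, boolPair z r ∈ A₁ ↔
      boolPair (boolUnpair z).1 (r.take (p₁.eval (boolUnpair z).1.length)) ∈ K₁ := fun z r => by
    change (truncSndFn p₁ ∘ mapFstFn fun z => (boolUnpair z).1) (boolPair z r) ∈ K₁ ↔ _
    rw [truncSnd_mapFst_fst_apply]
  have hmemW : ∀ r : List Bool, boolPair w r ∈ W ↔
      (((boolUnpair w).2).head? = some false ∧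
          boolPair (boolUnpair w).1 (r.take (p₀.eval (boolUnpair w).1.length)) ∈ K₀) ∨
        (((boolUnpair w).2).head? = some true ∧
          boolPair (boolUnpair w).1 (r.take (p₁.eval (boolUnpair w).1.length)) ∈ K₁) := by
    intro r
    change (mapSndFn ((fun z => (boolUnpair z).2) ∘ fun z => (boolUnpair z).1) ∘ copyFn)
        (boolPair w r) ∈ tagJoin A₀ A₁ ↔ _
    rw [tagCarrier_apply, mem_tagJoin_iff, boolUnpair_boolPair, hmemA₀, hmemA₁]
  have hule : (boolUnpair w).1.length ≤ w.length := length_boolUnpair_fst_le w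
  have hle₀ : p₀.eval (boolUnpair w).1.length ≤ (p₀ + p₁).eval w.length := by
    rw [Polynomial.eval_add]
    exact (TM2Iter.eval_mono p₀ hule).trans (Nat.le_add_right _ _)
  have hle₁ : p₁.eval (boolUnpair w).1.length ≤ (p₀ + p₁).eval w.length := by
    rw [Polynomial.eval_add]
    exact (TM2Iter.eval_mono p₁ hule).trans (Nat.le_add_left _ _)
  rw [mem_tagJoin_iff]
  rcases ht : ((boolUnpair w).2).head? with _ | c
  · -- untagged: not in the join, and no coin string is accepting
    have hset : {r : List Bool | boolPair w r ∈ W} = ∅ :=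
      Set.eq_empty_of_forall_notMem fun r hr => by
        have := (hmemW r).1 hr
        rw [ht] at this
        simp at this
    rw [hset, uniformProb_empty]
    simp only [reduceCtorEq, false_and, or_self, false_iff, not_lt]
    norm_num
  · cases c with
    | false =>
      have hset : {r : List Bool | boolPair w r ∈ W} =
          {r | r.take (p₀.eval (boolUnpair w).1.length) ∈ {y | boolPair (boolUnpair w).1 y ∈ K₀}} := by
        ext r
        rw [Set.mem_setOf_eq, hmemW r, ht]
        simp
      rw [hset, uniformProb_take_of_le hle₀, ← hp₀]
      simp
    | true =>
      have hset : {r : List Bool | boolPair w r ∈ W} =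
          {r | r.take (p₁.eval (boolUnpair w).1.length) ∈ {y | boolPair (boolUnpair w).1 y ∈ K₁}} := by
        ext r
        rw [Set.mem_setOf_eq, hmemW r, ht]
        simp
      rw [hset, uniformProb_take_of_le hle₁, ← hp₁]
      simp

/-- **Every level `CₖP` is closed under tagged joins** (induction on `k`). [cite: Toran1991, §3] -/
theorem tagJoin_mem_CkP (k : ℕ) :
    ∀ ⦃L₀ : Language Bool⦄, L₀ ∈ CkP k → ∀ ⦃L₁ : Language Bool⦄, L₁ ∈ CkP k →
      tagJoin L₀ L₁ ∈ CkP k := by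
  induction k with
  | zero => intro L₀ h₀ L₁ h₁; exact tagJoin_mem_P h₀ h₁
  | succ k ih => intro L₀ h₀ L₁ h₁; exact tagJoin_mem_pMajority (preimage_mem_CkP k) ih h₀ h₁

/-- `CH` is closed under tagged joins. [cite: Toran1991, §3] -/
theorem tagJoin_mem_CH {L₀ L₁ : Language Bool} (h₀ : L₀ ∈ CH) (h₁ : L₁ ∈ CH) :
    tagJoin L₀ L₁ ∈ CH := by
  obtain ⟨k₀, hk₀⟩ := mem_CH_iff.1 h₀
  obtain ⟨k₁, hk₁⟩ := mem_CH_iff.1 h₁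
  exact CkP_subset_CH (max k₀ k₁)
    (tagJoin_mem_CkP _ (CkP_mono (le_max_left _ _) hk₀) (CkP_mono (le_max_right _ _) hk₁))

/-! ### Intersection and union, one level up -/

/-- **One majority coin merges a tagged join into an intersection**: if `L₀ ⊎ L₁ ∈ K` then
`L₀ ∩ L₁ ∈ C'·K`, with the witness `L₀ ⊎ L₁` itself and one coin `c`: the coin string `[c]` is
accepting iff `x ∈ L_c`, so strictly more than half of the two coin strings accept iff
`x ∈ L₀ ∩ L₁` (Torán 1991, §3–4; Wagner 1986). [cite: Toran1991, §3] -/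
theorem inter_mem_pMajority_of_tagJoin {K : Set (Language Bool)} {L₀ L₁ : Language Bool}
    (h : tagJoin L₀ L₁ ∈ K) : L₀ ⊓ L₁ ∈ pMajority K := by
  classical
  refine ⟨tagJoin L₀ L₁, h, 1, fun x => ?_⟩
  rw [Polynomial.eval_one, half_lt_uniformProb_iff,
    show cnt 1 {y : List Bool | boolPair x y ∈ tagJoin L₀ L₁} = _ from cnt_succ 0 _, cnt_zero, cnt_zero]
  simp only [Set.mem_setOf_eq, boolPair_cons_mem_tagJoin, true_and, Bool.true_eq_false,
    Bool.false_eq_true, false_and, or_false, false_or]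
  change x ∈ L₀ ∧ x ∈ L₁ ↔ _
  by_cases hx₀ : x ∈ L₀ <;> by_cases hx₁ : x ∈ L₁ <;> simp [hx₀, hx₁]

/-- `L₀, L₁ ∈ CₖP ⇒ L₀ ∩ L₁ ∈ Cₖ₊₁P`. [cite: Toran1991, §3] -/
theorem inter_mem_CkP_succ {k : ℕ} {L₀ L₁ : Language Bool} (h₀ : L₀ ∈ CkP k) (h₁ : L₁ ∈ CkP k) :
    L₀ ⊓ L₁ ∈ CkP (k + 1) :=
  inter_mem_pMajority_of_tagJoin (tagJoin_mem_CkP k h₀ h₁)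

/-- `L₀, L₁ ∈ CₖP ⇒ L₀ ∪ L₁ ∈ Cₖ₊₁P` (De Morgan with `CkP_closed_compl`). [cite: Toran1991, §3] -/
theorem union_mem_CkP_succ {k : ℕ} {L₀ L₁ : Language Bool} (h₀ : L₀ ∈ CkP k) (h₁ : L₁ ∈ CkP k) :
    L₀ ⊔ L₁ ∈ CkP (k + 1) := by
  have h := CkP_closed_compl (k + 1) (inter_mem_CkP_succ (CkP_closed_compl k h₀) (CkP_closed_compl k h₁))
  have heq : (L₀ᶜ ⊓ L₁ᶜ)ᶜ = L₀ ⊔ L₁ := by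
    rw [compl_inf, compl_compl, compl_compl]
  rwa [heq] at h

/-- **`CH` is closed under intersection.** [cite: Toran1991, §3] -/
theorem inter_mem_CH {L₀ L₁ : Language Bool} (h₀ : L₀ ∈ CH) (h₁ : L₁ ∈ CH) : L₀ ⊓ L₁ ∈ CH := by
  obtain ⟨k₀, hk₀⟩ := mem_CH_iff.1 h₀
  obtain ⟨k₁, hk₁⟩ := mem_CH_iff.1 h₁
  exact CkP_subset_CH (max k₀ k₁ + 1)
    (inter_mem_CkP_succ (CkP_mono (le_max_left _ _) hk₀) (CkP_mono (le_max_right _ _) hk₁))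

/-- **`CH` is closed under union.** [cite: Toran1991, §3] -/
theorem union_mem_CH {L₀ L₁ : Language Bool} (h₀ : L₀ ∈ CH) (h₁ : L₁ ∈ CH) : L₀ ⊔ L₁ ∈ CH := by
  obtain ⟨k₀, hk₀⟩ := mem_CH_iff.1 h₀
  obtain ⟨k₁, hk₁⟩ := mem_CH_iff.1 h₁
  exact CkP_subset_CH (max k₀ k₁ + 1)
    (union_mem_CkP_succ (CkP_mono (le_max_left _ _) hk₀) (CkP_mono (le_max_right _ _) hk₁))

/-- The full language is in `P` (as `T ⊔ Tᶜ` for a `P` language `T`). [folklore] -/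
theorem top_mem_P : (⊤ : Language Bool) ∈ Classes.P := by
  have h := union_mem_P (sndStartsWith_mem_P false) (compl_mem_P_iff.2 (sndStartsWith_mem_P false))
  rwa [sup_compl_eq_top] at h

/-- The empty language is in `P`. [folklore] -/
theorem bot_mem_P : (⊥ : Language Bool) ∈ Classes.P := by
  have h := compl_mem_P_iff.2 top_mem_P
  rwa [compl_top] at h

/-- Finite intersections of `CH` languages are in `CH`. [cite: Toran1991, §3] -/
theorem finset_inf_mem_CH {ι : Type*} (s : Finset ι) (L : ι → Language Bool)
    (h : ∀ i ∈ s, L i ∈ CH) : s.inf L ∈ CH := by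
  classical
  induction s using Finset.induction_on with
  | empty =>
    rw [Finset.inf_empty]
    exact P_subset_CH top_mem_P
  | insert a s ha ih =>
    rw [Finset.inf_insert]
    exact inter_mem_CH (h a (Finset.mem_insert_self a s)) (ih fun i hi => h i (Finset.mem_insert_of_mem hi))

/-- Finite unions of `CH` languages are in `CH`. [cite: Toran1991, §3] -/
theorem finset_sup_mem_CH {ι : Type*} (s : Finset ι) (L : ι → Language Bool)
    (h : ∀ i ∈ s, L i ∈ CH) : s.sup L ∈ CH := by
  classical
  induction s using Finset.induction_on with
  | empty =>
    rw [Finset.sup_empty]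
    exact P_subset_CH bot_mem_P
  | insert a s ha ih =>
    rw [Finset.sup_insert]
    exact union_mem_CH (h a (Finset.mem_insert_self a s)) (ih fun i hi => h i (Finset.mem_insert_of_mem hi))

end Literature.Computability.Complexity
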